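import Literature.Analysis.FluidPDE.FiniteFourierModeEulerVec

/-!
# Kishimoto–Yoneda, §2: Lemma 2.1 and Proposition 2.2 (interaction between two modes)

Support file for `FiniteFourierModeEuler` (N. Kishimoto, T. Yoneda, J. Math. Fluid Mech. 24
(2022) 74 = arXiv:2110.08039), formalising **Lemma 2.1**, **Proposition 2.2** and
**Remark 2.4**, all PROVED.

Instead of the paper's orthonormal frame `(e^∥_n, e^⊥)` we use the UNNORMALISED frame
`k := n₁ × n₂` (normal of the plane of the two frequencies) and `p_j := k × n_j`
(`p_j = |k||n_j| e^∥_{n_j}`, `k = |k| e^⊥`), which avoids square roots: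

* every divergence-free `u_j` is `α_j p_j + β_j k` (`frame_identity`, `exists_frame`, uniqueness
  `frame_eq_iff`);
* **Lemma 2.1** (`proj_bracket_frame`):
  `|m|² P̂_m[(u₁·n₂)u₂ + (u₂·n₁)u₁] = |k|² [ α₁α₂ (|n₂|² - |n₁|²) (k × m) + |m|² (α₁β₂ - α₂β₁) k ]`,
  `m = n₁ + n₂`, i.e. the displayed formula of the paper after multiplying by `|m||k|²|n₁||n₂|`;
* the non-interaction criterion (`nonInteracting_frame_iff`, Lemma 2.1 bullets / Remark 2.4):
  `α₁α₂(|n₁|² - |n₂|²) = 0 ∧ α₁β₂ = α₂β₁`;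
* **Proposition 2.2 (ii),(iii) / Remark 2.4** in uniform form (`nonInteracting_transport`): for
  independent frequencies and non-zero vectors, non-interaction forces `(α₂, β₂) = γ(α₁, β₁)`,
  `γ ≠ 0` (i.e. `u₂ = γ 𝓡_{n̂₁↦n̂₂} u₁` in case (iii), both vectors normal to the plane in case
  (ii)) and `|n₁| = |n₂|` unless `α₁ = α₂ = 0`; and the converse directions
  (`nonInteracting_of_proportional`, `nonInteracting_of_normal`). Part (i) (dependent
  frequencies) is `KY.bracket_eq_zero_of_cross_eq_zero` in `FiniteFourierModeEulerVec`.

## References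

* [KishimotoYoneda2022] N. Kishimoto, T. Yoneda, J. Math. Fluid Mech. 24 (2022) 74 =
  arXiv:2110.08039, §2: Lemma 2.1, Proposition 2.2, Remark 2.4.
-/

noncomputable section

open Matrix

namespace Literature.Analysis.FluidPDE

namespace KY

/-! ### The frame `k = n₁ × n₂`, `p_j = k × n_j` (Lemma 2.1 without square roots) -/

/-- Resolution of a vector of `ℂ³` in the orthogonal frame `(n₁, p₁, k)`, `k = n₁ × n₂`,
`p₁ = k × n₁` (`|p₁|² = |k|²|n₁|²`): `|k|²|n₁|² u = (u·p₁) p₁ + |n₁|² (u·k) k + |k|² (n₁·u) n₁`.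
[cite: KishimotoYoneda2022, §2 Lemma 2.1 ("write `u_j = u_j^∥ e^∥_{n_j} + u_j^⊥ e^⊥`")] -/
theorem frame_identity₁ (n₁ n₂ : Fin 3 → ℝ) (u : Fin 3 → ℂ) :
    (((n₁ ⨯₃ n₂) ⬝ᵥ (n₁ ⨯₃ n₂) * (n₁ ⬝ᵥ n₁) : ℝ) : ℂ) • u
      = dot u (cplx ((n₁ ⨯₃ n₂) ⨯₃ n₁)) • cplx ((n₁ ⨯₃ n₂) ⨯₃ n₁)
        + (((n₁ ⬝ᵥ n₁ : ℝ) : ℂ) * dot u (cplx (n₁ ⨯₃ n₂))) • cplx (n₁ ⨯₃ n₂)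
        + ((((n₁ ⨯₃ n₂) ⬝ᵥ (n₁ ⨯₃ n₂) : ℝ) : ℂ) * dot (cplx n₁) u) • cplx n₁ := by
  rw [vec3_eq_iff]
  simp only [dot_eq, real_dot_eq, cplx_apply, cross_apply, Pi.add_apply, 
      Pi.smul_apply, smul_eq_mul, Matrix.cons_val_zero, Matrix.cons_val_one,
      Matrix.head_cons, Matrix.cons_val_two, Matrix.tail_cons, 
      Fin.isValue]
  push_cast
  refine ⟨?_, ?_, ?_⟩ <;> ring

/-- The same resolution at the second frequency, frame `(n₂, p₂, k)`, `p₂ = k × n₂`.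
[cite: KishimotoYoneda2022, §2 Lemma 2.1] -/
theorem frame_identity₂ (n₁ n₂ : Fin 3 → ℝ) (u : Fin 3 → ℂ) :
    (((n₁ ⨯₃ n₂) ⬝ᵥ (n₁ ⨯₃ n₂) * (n₂ ⬝ᵥ n₂) : ℝ) : ℂ) • u
      = dot u (cplx ((n₁ ⨯₃ n₂) ⨯₃ n₂)) • cplx ((n₁ ⨯₃ n₂) ⨯₃ n₂)
        + (((n₂ ⬝ᵥ n₂ : ℝ) : ℂ) * dot u (cplx (n₁ ⨯₃ n₂))) • cplx (n₁ ⨯₃ n₂)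
        + ((((n₁ ⨯₃ n₂) ⬝ᵥ (n₁ ⨯₃ n₂) : ℝ) : ℂ) * dot (cplx n₂) u) • cplx n₂ := by
  rw [vec3_eq_iff]
  simp only [dot_eq, real_dot_eq, cplx_apply, cross_apply, Pi.add_apply, 
      Pi.smul_apply, smul_eq_mul, Matrix.cons_val_zero, Matrix.cons_val_one,
      Matrix.head_cons, Matrix.cons_val_two, Matrix.tail_cons, 
      Fin.isValue]
  push_cast
  refine ⟨?_, ?_, ?_⟩ <;> ring

/-- `k = n₁ × n₂ = 0` when `n₁ + n₂ = 0`. [folklore] -/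
theorem cross_eq_zero_of_add_eq_zero {n₁ n₂ : Fin 3 → ℝ} (h : n₁ + n₂ = 0) : n₁ ⨯₃ n₂ = 0 := by
  have : n₂ = -n₁ := by rw [← sub_eq_zero, sub_neg_eq_add, add_comm, h]
  subst this
  rw [LinearMap.map_neg, cross_self, neg_zero]

/-- [folklore] -/
theorem add_ne_zero_of_cross_ne_zero {n₁ n₂ : Fin 3 → ℝ} (hk : n₁ ⨯₃ n₂ ≠ 0) : n₁ + n₂ ≠ 0 :=
  fun h => hk (cross_eq_zero_of_add_eq_zero h)

/-- [folklore] -/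
theorem left_ne_zero_of_cross_ne_zero {n₁ n₂ : Fin 3 → ℝ} (hk : n₁ ⨯₃ n₂ ≠ 0) : n₁ ≠ 0 := by
  rintro rfl; exact hk (by rw [LinearMap.map_zero₂])

/-- [folklore] -/
theorem right_ne_zero_of_cross_ne_zero {n₁ n₂ : Fin 3 → ℝ} (hk : n₁ ⨯₃ n₂ ≠ 0) : n₂ ≠ 0 := by
  rintro rfl; exact hk (by rw [map_zero])

/-- `|k × n₁|² = |k|² |n₁|²` for `k = n₁ × n₂`. [folklore] -/
theorem frame_p₁_sq (n₁ n₂ : Fin 3 → ℝ) :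
    ((n₁ ⨯₃ n₂) ⨯₃ n₁) ⬝ᵥ ((n₁ ⨯₃ n₂) ⨯₃ n₁) = (n₁ ⨯₃ n₂) ⬝ᵥ (n₁ ⨯₃ n₂) * (n₁ ⬝ᵥ n₁) := by
  simp only [real_dot_eq, cross_apply, Matrix.cons_val_zero, Matrix.cons_val_one,
      Matrix.head_cons, Matrix.cons_val_two, Matrix.tail_cons]
  ring

/-- `|k × n₂|² = |k|² |n₂|²` for `k = n₁ × n₂`. [folklore] -/
theorem frame_p₂_sq (n₁ n₂ : Fin 3 → ℝ) :
    ((n₁ ⨯₃ n₂) ⨯₃ n₂) ⬝ᵥ ((n₁ ⨯₃ n₂) ⨯₃ n₂) = (n₁ ⨯₃ n₂) ⬝ᵥ (n₁ ⨯₃ n₂) * (n₂ ⬝ᵥ n₂) := by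
  simp only [real_dot_eq, cross_apply, Matrix.cons_val_zero, Matrix.cons_val_one,
      Matrix.head_cons, Matrix.cons_val_two, Matrix.tail_cons]
  ring

/-- `p₁ ⊥ k`. [folklore] -/
theorem p₁_dot_k (n₁ n₂ : Fin 3 → ℝ) : ((n₁ ⨯₃ n₂) ⨯₃ n₁) ⬝ᵥ (n₁ ⨯₃ n₂) = 0 := by
  simp only [real_dot_eq, cross_apply, Matrix.cons_val_zero, Matrix.cons_val_one,
      Matrix.head_cons, Matrix.cons_val_two, Matrix.tail_cons]
  ring

/-- `k ⊥ p₁`. [folklore] -/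
theorem k_dot_p₁ (n₁ n₂ : Fin 3 → ℝ) : (n₁ ⨯₃ n₂) ⬝ᵥ ((n₁ ⨯₃ n₂) ⨯₃ n₁) = 0 := by
  rw [dotProduct_comm, p₁_dot_k]

/-- `p₂ ⊥ k`. [folklore] -/
theorem p₂_dot_k (n₁ n₂ : Fin 3 → ℝ) : ((n₁ ⨯₃ n₂) ⨯₃ n₂) ⬝ᵥ (n₁ ⨯₃ n₂) = 0 := by
  simp only [real_dot_eq, cross_apply, Matrix.cons_val_zero, Matrix.cons_val_one,
      Matrix.head_cons, Matrix.cons_val_two, Matrix.tail_cons]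
  ring

/-- `k ⊥ p₂`. [folklore] -/
theorem k_dot_p₂ (n₁ n₂ : Fin 3 → ℝ) : (n₁ ⨯₃ n₂) ⬝ᵥ ((n₁ ⨯₃ n₂) ⨯₃ n₂) = 0 := by
  rw [dotProduct_comm, p₂_dot_k]

/-- `k × m ⊥ k` (`m = n₁ + n₂`). [folklore] -/
theorem km_dot_k (n₁ n₂ : Fin 3 → ℝ) : ((n₁ ⨯₃ n₂) ⨯₃ (n₁ + n₂)) ⬝ᵥ (n₁ ⨯₃ n₂) = 0 := by
  simp only [real_dot_eq, cross_apply, Pi.add_apply, Matrix.cons_val_zero, Matrix.cons_val_one,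
      Matrix.head_cons, Matrix.cons_val_two, Matrix.tail_cons]
  ring

/-- `k ⊥ k × m`. [folklore] -/
theorem k_dot_km (n₁ n₂ : Fin 3 → ℝ) : (n₁ ⨯₃ n₂) ⬝ᵥ ((n₁ ⨯₃ n₂) ⨯₃ (n₁ + n₂)) = 0 := by
  rw [dotProduct_comm, km_dot_k]

/-- Frame coordinates are unique (first frequency): `a p₁ + b k = c p₁ + d k ↔ a = c ∧ b = d`.
[cite: KishimotoYoneda2022, §2 Lemma 2.1] -/
theorem frame_eq_iff₁ {n₁ n₂ : Fin 3 → ℝ} (hk : n₁ ⨯₃ n₂ ≠ 0) (a b c d : ℂ) :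
    a • cplx ((n₁ ⨯₃ n₂) ⨯₃ n₁) + b • cplx (n₁ ⨯₃ n₂)
        = c • cplx ((n₁ ⨯₃ n₂) ⨯₃ n₁) + d • cplx (n₁ ⨯₃ n₂) ↔ a = c ∧ b = d := by
  have hn₁ := left_ne_zero_of_cross_ne_zero hk
  have hK : (((n₁ ⨯₃ n₂) ⬝ᵥ (n₁ ⨯₃ n₂) : ℝ) : ℂ) ≠ 0 := by exact_mod_cast real_dot_self_ne_zero hk
  have hP : ((((n₁ ⨯₃ n₂) ⨯₃ n₁) ⬝ᵥ ((n₁ ⨯₃ n₂) ⨯₃ n₁) : ℝ) : ℂ) ≠ 0 := by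
    rw [frame_p₁_sq]; push_cast
    exact mul_ne_zero hK (by exact_mod_cast real_dot_self_ne_zero hn₁)
  constructor
  · intro h
    have h1 := congrArg (dot (cplx ((n₁ ⨯₃ n₂) ⨯₃ n₁))) h
    have h2 := congrArg (dot (cplx (n₁ ⨯₃ n₂))) h
    simp only [dot_add_right, dot_smul_right, dot_cplx_cplx, p₁_dot_k, k_dot_p₁, Complex.ofReal_zero,
      mul_zero, add_zero, zero_add] at h1 h2
    exact ⟨mul_right_cancel₀ hP h1, mul_right_cancel₀ hK h2⟩
  · rintro ⟨rfl, rfl⟩; rfl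

/-- Frame coordinates are unique (second frequency). [cite: KishimotoYoneda2022, §2 Lemma 2.1] -/
theorem frame_eq_iff₂ {n₁ n₂ : Fin 3 → ℝ} (hk : n₁ ⨯₃ n₂ ≠ 0) (a b c d : ℂ) :
    a • cplx ((n₁ ⨯₃ n₂) ⨯₃ n₂) + b • cplx (n₁ ⨯₃ n₂)
        = c • cplx ((n₁ ⨯₃ n₂) ⨯₃ n₂) + d • cplx (n₁ ⨯₃ n₂) ↔ a = c ∧ b = d := by
  have hn₂ := right_ne_zero_of_cross_ne_zero hk
  have hK : (((n₁ ⨯₃ n₂) ⬝ᵥ (n₁ ⨯₃ n₂) : ℝ) : ℂ) ≠ 0 := by exact_mod_cast real_dot_self_ne_zero hk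
  have hP : ((((n₁ ⨯₃ n₂) ⨯₃ n₂) ⬝ᵥ ((n₁ ⨯₃ n₂) ⨯₃ n₂) : ℝ) : ℂ) ≠ 0 := by
    rw [frame_p₂_sq]; push_cast
    exact mul_ne_zero hK (by exact_mod_cast real_dot_self_ne_zero hn₂)
  constructor
  · intro h
    have h1 := congrArg (dot (cplx ((n₁ ⨯₃ n₂) ⨯₃ n₂))) h
    have h2 := congrArg (dot (cplx (n₁ ⨯₃ n₂))) h
    simp only [dot_add_right, dot_smul_right, dot_cplx_cplx, p₂_dot_k, k_dot_p₂, Complex.ofReal_zero,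
      mul_zero, add_zero, zero_add] at h1 h2
    exact ⟨mul_right_cancel₀ hP h1, mul_right_cancel₀ hK h2⟩
  · rintro ⟨rfl, rfl⟩; rfl

/-- A frame vector at `n₁` vanishes iff both coordinates do. [cite: KishimotoYoneda2022, §2 Lemma 2.1] -/
theorem frame_eq_zero_iff₁ {n₁ n₂ : Fin 3 → ℝ} (hk : n₁ ⨯₃ n₂ ≠ 0) (a b : ℂ) :
    a • cplx ((n₁ ⨯₃ n₂) ⨯₃ n₁) + b • cplx (n₁ ⨯₃ n₂) = 0 ↔ a = 0 ∧ b = 0 := by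
  have := frame_eq_iff₁ hk a b 0 0
  simpa using this

/-- A frame vector at `n₂` vanishes iff both coordinates do. [cite: KishimotoYoneda2022, §2 Lemma 2.1] -/
theorem frame_eq_zero_iff₂ {n₁ n₂ : Fin 3 → ℝ} (hk : n₁ ⨯₃ n₂ ≠ 0) (a b : ℂ) :
    a • cplx ((n₁ ⨯₃ n₂) ⨯₃ n₂) + b • cplx (n₁ ⨯₃ n₂) = 0 ↔ a = 0 ∧ b = 0 := by
  have := frame_eq_iff₂ hk a b 0 0
  simpa using this

/-- Frame vectors at `n₁` are divergence-free: `n₁ · (a p₁ + b k) = 0`. [cite: KishimotoYoneda2022, §2 Lemma 2.1] -/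
theorem dot_frame₁ (n₁ n₂ : Fin 3 → ℝ) (a b : ℂ) :
    dot (cplx n₁) (a • cplx ((n₁ ⨯₃ n₂) ⨯₃ n₁) + b • cplx (n₁ ⨯₃ n₂)) = 0 := by
  simp only [dot_eq, cplx_apply, cross_apply, Pi.add_apply, 
      Pi.smul_apply, smul_eq_mul, Matrix.cons_val_zero, Matrix.cons_val_one,
      Matrix.head_cons, Matrix.cons_val_two, Matrix.tail_cons, 
      Fin.isValue]
  push_cast
  ring

/-- Frame vectors at `n₂` are divergence-free. [cite: KishimotoYoneda2022, §2 Lemma 2.1] -/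
theorem dot_frame₂ (n₁ n₂ : Fin 3 → ℝ) (a b : ℂ) :
    dot (cplx n₂) (a • cplx ((n₁ ⨯₃ n₂) ⨯₃ n₂) + b • cplx (n₁ ⨯₃ n₂)) = 0 := by
  simp only [dot_eq, cplx_apply, cross_apply, Pi.add_apply, 
      Pi.smul_apply, smul_eq_mul, Matrix.cons_val_zero, Matrix.cons_val_one,
      Matrix.head_cons, Matrix.cons_val_two, Matrix.tail_cons, 
      Fin.isValue]
  push_cast
  ring

/-- Every divergence-free vector at `n₁` has frame coordinates (`n₁, n₂` independent).
[cite: KishimotoYoneda2022, §2 Lemma 2.1] -/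
theorem exists_frame₁ {n₁ n₂ : Fin 3 → ℝ} (hk : n₁ ⨯₃ n₂ ≠ 0) {u : Fin 3 → ℂ}
    (hu : dot (cplx n₁) u = 0) :
    ∃ a b : ℂ, u = a • cplx ((n₁ ⨯₃ n₂) ⨯₃ n₁) + b • cplx (n₁ ⨯₃ n₂) := by
  have hn₁ := left_ne_zero_of_cross_ne_zero hk
  set K : ℝ := (n₁ ⨯₃ n₂) ⬝ᵥ (n₁ ⨯₃ n₂) with hKdef
  set N : ℝ := n₁ ⬝ᵥ n₁ with hNdef
  have hK : (K : ℂ) ≠ 0 := by exact_mod_cast real_dot_self_ne_zero hk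
  have hN : (N : ℂ) ≠ 0 := by exact_mod_cast real_dot_self_ne_zero hn₁
  have h := frame_identity₁ n₁ n₂ u
  rw [hu, mul_zero, zero_smul, add_zero] at h
  refine ⟨dot u (cplx ((n₁ ⨯₃ n₂) ⨯₃ n₁)) / ((K : ℂ) * N), dot u (cplx (n₁ ⨯₃ n₂)) / K, ?_⟩
  have hKN : ((K * N : ℝ) : ℂ) ≠ 0 := by push_cast; exact mul_ne_zero hK hN
  apply smul_right_injective (Fin 3 → ℂ) hKN
  dsimp only
  rw [h, smul_add, smul_smul, smul_smul]
  push_cast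
  rw [mul_div_cancel₀ _ (mul_ne_zero hK hN)]
  congr 2
  field_simp
  ring

/-- Every divergence-free vector at `n₂` has frame coordinates (`n₁, n₂` independent).
[cite: KishimotoYoneda2022, §2 Lemma 2.1] -/
theorem exists_frame₂ {n₁ n₂ : Fin 3 → ℝ} (hk : n₁ ⨯₃ n₂ ≠ 0) {u : Fin 3 → ℂ}
    (hu : dot (cplx n₂) u = 0) :
    ∃ a b : ℂ, u = a • cplx ((n₁ ⨯₃ n₂) ⨯₃ n₂) + b • cplx (n₁ ⨯₃ n₂) := by
  have hn₂ := right_ne_zero_of_cross_ne_zero hk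
  set K : ℝ := (n₁ ⨯₃ n₂) ⬝ᵥ (n₁ ⨯₃ n₂) with hKdef
  set N : ℝ := n₂ ⬝ᵥ n₂ with hNdef
  have hK : (K : ℂ) ≠ 0 := by exact_mod_cast real_dot_self_ne_zero hk
  have hN : (N : ℂ) ≠ 0 := by exact_mod_cast real_dot_self_ne_zero hn₂
  have h := frame_identity₂ n₁ n₂ u
  rw [hu, mul_zero, zero_smul, add_zero] at h
  refine ⟨dot u (cplx ((n₁ ⨯₃ n₂) ⨯₃ n₂)) / ((K : ℂ) * N), dot u (cplx (n₁ ⨯₃ n₂)) / K, ?_⟩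
  have hKN : ((K * N : ℝ) : ℂ) ≠ 0 := by push_cast; exact mul_ne_zero hK hN
  apply smul_right_injective (Fin 3 → ℂ) hKN
  dsimp only
  rw [h, smul_add, smul_smul, smul_smul]
  push_cast
  rw [mul_div_cancel₀ _ (mul_ne_zero hK hN)]
  congr 2
  field_simp
  ring

/-- **Lemma 2.1 (unnormalised).** For `u_j = α_j p_j + β_j k` (`k = n₁ × n₂`, `p_j = k × n_j`,
`m = n₁ + n₂`):
`|m|² P̂_m[(u₁·n₂)u₂ + (u₂·n₁)u₁] = |k|² ( α₁α₂(|n₂|² - |n₁|²) (k × m) + |m|²(α₁β₂ - α₂β₁) k )`.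
With `p_j = |k||n_j| e^∥_{n_j}`, `k = |k| e^⊥` this is the displayed formula of Lemma 2.1.
[cite: KishimotoYoneda2022, §2 Lemma 2.1] -/
theorem proj_bracket_frame (n₁ n₂ : Fin 3 → ℝ) (α₁ β₁ α₂ β₂ : ℂ) {u₁ u₂ : Fin 3 → ℂ}
    (hu₁ : u₁ = α₁ • cplx ((n₁ ⨯₃ n₂) ⨯₃ n₁) + β₁ • cplx (n₁ ⨯₃ n₂))
    (hu₂ : u₂ = α₂ • cplx ((n₁ ⨯₃ n₂) ⨯₃ n₂) + β₂ • cplx (n₁ ⨯₃ n₂)) :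
    dot (cplx (n₁ + n₂)) (cplx (n₁ + n₂)) • proj (n₁ + n₂) (bracket n₁ n₂ u₁ u₂)
      = (((n₁ ⨯₃ n₂) ⬝ᵥ (n₁ ⨯₃ n₂) : ℝ) : ℂ) •
        ((α₁ * α₂ * ((n₂ ⬝ᵥ n₂ - n₁ ⬝ᵥ n₁ : ℝ) : ℂ)) • cplx ((n₁ ⨯₃ n₂) ⨯₃ (n₁ + n₂))
          + ((((n₁ + n₂) ⬝ᵥ (n₁ + n₂) : ℝ) : ℂ) * (α₁ * β₂ - α₂ * β₁)) • cplx (n₁ ⨯₃ n₂)) := by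
  by_cases hm : n₁ + n₂ = 0
  · rw [cross_eq_zero_of_add_eq_zero hm, hm]
    simp
  rw [dot_smul_proj hm, hu₁, hu₂, vec3_eq_iff]
  simp only [bracket, dot_eq, real_dot_eq, cplx_apply, cross_apply, Pi.add_apply, Pi.sub_apply,
      Pi.smul_apply, smul_eq_mul, Matrix.cons_val_zero, Matrix.cons_val_one,
      Matrix.head_cons, Matrix.cons_val_two, Matrix.tail_cons, 
      Fin.isValue]
  push_cast
  refine ⟨?_, ?_, ?_⟩ <;> ring

/-- `|k × m|² = |k|² |m|²` (`k = n₁ × n₂ ⊥ m = n₁ + n₂`). [folklore] -/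
theorem cross_k_m_sq (n₁ n₂ : Fin 3 → ℝ) :
    ((n₁ ⨯₃ n₂) ⨯₃ (n₁ + n₂)) ⬝ᵥ ((n₁ ⨯₃ n₂) ⨯₃ (n₁ + n₂))
      = (n₁ ⨯₃ n₂) ⬝ᵥ (n₁ ⨯₃ n₂) * ((n₁ + n₂) ⬝ᵥ (n₁ + n₂)) := by
  simp only [real_dot_eq, cross_apply, Pi.add_apply, Matrix.cons_val_zero, Matrix.cons_val_one,
      Matrix.head_cons, Matrix.cons_val_two, Matrix.tail_cons]
  ring

/-- **Lemma 2.1, criterion form / Remark 2.4.** For independent `n₁, n₂` and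
`u_j = α_j p_j + β_j k`, the modes do not interact iff
`α₁α₂(|n₁|² - |n₂|²) = 0` and `α₁β₂ = α₂β₁` (paper: `u₁^∥u₂^∥(|n₁|²-|n₂|²) = 0`,
`u₁^∥u₂^⊥|n₂| = u₂^∥u₁^⊥|n₁|`). [cite: KishimotoYoneda2022, §2 Lemma 2.1 and Remark 2.4] -/
theorem nonInteracting_frame_iff {n₁ n₂ : Fin 3 → ℝ} (hk : n₁ ⨯₃ n₂ ≠ 0) {α₁ β₁ α₂ β₂ : ℂ}
    {u₁ u₂ : Fin 3 → ℂ}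
    (hu₁ : u₁ = α₁ • cplx ((n₁ ⨯₃ n₂) ⨯₃ n₁) + β₁ • cplx (n₁ ⨯₃ n₂))
    (hu₂ : u₂ = α₂ • cplx ((n₁ ⨯₃ n₂) ⨯₃ n₂) + β₂ • cplx (n₁ ⨯₃ n₂)) :
    NonInteracting n₁ n₂ u₁ u₂ ↔
      α₁ * α₂ * ((n₁ ⬝ᵥ n₁ - n₂ ⬝ᵥ n₂ : ℝ) : ℂ) = 0 ∧ α₁ * β₂ = α₂ * β₁ := by
  have hm := add_ne_zero_of_cross_ne_zero hk
  have hD : dot (cplx (n₁ + n₂)) (cplx (n₁ + n₂)) ≠ 0 := dot_cplx_self_ne_zero hm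
  have hD' : (((n₁ + n₂) ⬝ᵥ (n₁ + n₂) : ℝ) : ℂ) ≠ 0 := by rwa [dot_cplx_cplx] at hD
  have hK : (((n₁ ⨯₃ n₂) ⬝ᵥ (n₁ ⨯₃ n₂) : ℝ) : ℂ) ≠ 0 := by exact_mod_cast real_dot_self_ne_zero hk
  have hKM : ((((n₁ ⨯₃ n₂) ⨯₃ (n₁ + n₂)) ⬝ᵥ ((n₁ ⨯₃ n₂) ⨯₃ (n₁ + n₂)) : ℝ) : ℂ) ≠ 0 := by
    rw [cross_k_m_sq]; push_cast; exact mul_ne_zero hK hD'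
  have key := proj_bracket_frame n₁ n₂ α₁ β₁ α₂ β₂ hu₁ hu₂
  unfold NonInteracting
  constructor
  · intro h
    rw [h, smul_zero] at key
    have key' := (smul_eq_zero.1 key.symm).resolve_left hK
    have h1 := congrArg (dot (cplx ((n₁ ⨯₃ n₂) ⨯₃ (n₁ + n₂)))) key'
    have h2 := congrArg (dot (cplx (n₁ ⨯₃ n₂))) key'
    simp only [dot_add_right, dot_smul_right, dot_cplx_cplx, dot_zero_right, km_dot_k, k_dot_km,
      Complex.ofReal_zero, mul_zero, add_zero, zero_add] at h1 h2
    refine ⟨?_, ?_⟩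
    · have : α₁ * α₂ * ((n₁ ⬝ᵥ n₁ - n₂ ⬝ᵥ n₂ : ℝ) : ℂ) = -(α₁ * α₂ * ((n₂ ⬝ᵥ n₂ - n₁ ⬝ᵥ n₁ : ℝ) : ℂ)) := by
        push_cast; ring
      rw [this, neg_eq_zero]; exact (mul_eq_zero.1 h1).resolve_right hKM
    · have := (mul_eq_zero.1 ((mul_eq_zero.1 h2).resolve_right hK)).resolve_left hD'
      exact sub_eq_zero.1 this
  · rintro ⟨h1, h2⟩
    have h1' : α₁ * α₂ * ((n₂ ⬝ᵥ n₂ - n₁ ⬝ᵥ n₁ : ℝ) : ℂ) = 0 := by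
      have : α₁ * α₂ * ((n₂ ⬝ᵥ n₂ - n₁ ⬝ᵥ n₁ : ℝ) : ℂ) = -(α₁ * α₂ * ((n₁ ⬝ᵥ n₁ - n₂ ⬝ᵥ n₂ : ℝ) : ℂ)) := by
        push_cast; ring
      rw [this, h1, neg_zero]
    rw [h1', h2, sub_self, mul_zero, zero_smul, zero_smul, add_zero, smul_zero] at key
    exact (smul_eq_zero.1 key).resolve_left hD


/-! ### Proposition 2.2: the structure of a non-interacting pair -/

/-- **Proposition 2.2 / Remark 2.4 (uniform form).** For linearly independent frequencies and
NON-ZERO divergence-free vectors `u_j = α_j p_j + β_j k`, non-interaction forces the frame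
coordinates to be proportional, `(α₂, β₂) = γ (α₁, β₁)` with `γ ≠ 0` (case (ii): `α₁ = α₂ = 0`;
case (iii): `u₂ = γ 𝓡_{n̂₁ ↦ n̂₂} u₁`), and in case `α₁ ≠ 0` (equivalently `α₂ ≠ 0`) also
`|n₁| = |n₂|`. [cite: KishimotoYoneda2022, §2 Prop. 2.2 and Remark 2.4] -/
theorem nonInteracting_transport {n₁ n₂ : Fin 3 → ℝ} (hk : n₁ ⨯₃ n₂ ≠ 0) {α₁ β₁ α₂ β₂ : ℂ}
    {u₁ u₂ : Fin 3 → ℂ}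
    (hu₁ : u₁ = α₁ • cplx ((n₁ ⨯₃ n₂) ⨯₃ n₁) + β₁ • cplx (n₁ ⨯₃ n₂))
    (hu₂ : u₂ = α₂ • cplx ((n₁ ⨯₃ n₂) ⨯₃ n₂) + β₂ • cplx (n₁ ⨯₃ n₂))
    (hne₁ : u₁ ≠ 0) (hne₂ : u₂ ≠ 0) (h : NonInteracting n₁ n₂ u₁ u₂) :
    (∃ γ : ℂ, γ ≠ 0 ∧ α₂ = γ * α₁ ∧ β₂ = γ * β₁) ∧ (α₁ ≠ 0 → n₁ ⬝ᵥ n₁ = n₂ ⬝ᵥ n₂) := by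
  obtain ⟨h1, h2⟩ := (nonInteracting_frame_iff hk hu₁ hu₂).1 h
  have hz₁ : ¬ (α₁ = 0 ∧ β₁ = 0) := by
    rintro ⟨rfl, rfl⟩; exact hne₁ (by rw [hu₁]; simp)
  have hz₂ : ¬ (α₂ = 0 ∧ β₂ = 0) := by
    rintro ⟨rfl, rfl⟩; exact hne₂ (by rw [hu₂]; simp)
  by_cases ha₁ : α₁ = 0
  · subst ha₁
    have hb₁ : β₁ ≠ 0 := fun hb => hz₁ ⟨rfl, hb⟩
    have ha₂ : α₂ = 0 := by
      rw [zero_mul] at h2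
      exact (mul_eq_zero.1 h2.symm).resolve_right hb₁
    subst ha₂
    have hb₂ : β₂ ≠ 0 := fun hb => hz₂ ⟨rfl, hb⟩
    refine ⟨⟨β₂ / β₁, div_ne_zero hb₂ hb₁, by simp, ?_⟩, fun h => (h rfl).elim⟩
    rw [div_mul_cancel₀ _ hb₁]
  · have ha₂ : α₂ ≠ 0 := by
      intro ha₂
      rw [ha₂, zero_mul] at h2
      have hb₂ : β₂ = 0 := (mul_eq_zero.1 h2).resolve_left ha₁
      exact hz₂ ⟨ha₂, hb₂⟩
    have hnn : n₁ ⬝ᵥ n₁ = n₂ ⬝ᵥ n₂ := by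
      have := (mul_eq_zero.1 h1).resolve_left (mul_ne_zero ha₁ ha₂)
      exact sub_eq_zero.1 (by exact_mod_cast this)
    refine ⟨⟨α₂ / α₁, div_ne_zero ha₂ ha₁, by rw [div_mul_cancel₀ _ ha₁], ?_⟩, fun _ => hnn⟩
    field_simp
    linear_combination h2

/-- Conversely, proportional frame coordinates at frequencies of equal length do not interact
(sufficiency of (iii)' in Remark 2.4). [cite: KishimotoYoneda2022, §2 Prop. 2.2 (iii)] -/
theorem nonInteracting_of_proportional {n₁ n₂ : Fin 3 → ℝ} (hk : n₁ ⨯₃ n₂ ≠ 0) {α₁ β₁ γ : ℂ}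
    {u₁ u₂ : Fin 3 → ℂ}
    (hu₁ : u₁ = α₁ • cplx ((n₁ ⨯₃ n₂) ⨯₃ n₁) + β₁ • cplx (n₁ ⨯₃ n₂))
    (hu₂ : u₂ = (γ * α₁) • cplx ((n₁ ⨯₃ n₂) ⨯₃ n₂) + (γ * β₁) • cplx (n₁ ⨯₃ n₂))
    (hn : α₁ = 0 ∨ n₁ ⬝ᵥ n₁ = n₂ ⬝ᵥ n₂) : NonInteracting n₁ n₂ u₁ u₂ := by
  rw [nonInteracting_frame_iff hk hu₁ hu₂]
  refine ⟨?_, by ring⟩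
  rcases hn with h | h
  · rw [h]; ring
  · rw [h, sub_self]; simp

/-- Sufficiency of (ii)' in Remark 2.4: two vectors normal to the plane of the frequencies do not
interact. [cite: KishimotoYoneda2022, §2 Prop. 2.2 (ii)] -/
theorem nonInteracting_of_normal {n₁ n₂ : Fin 3 → ℝ} (hk : n₁ ⨯₃ n₂ ≠ 0) (β₁ β₂ : ℂ) :
    NonInteracting n₁ n₂ (β₁ • cplx (n₁ ⨯₃ n₂)) (β₂ • cplx (n₁ ⨯₃ n₂)) := by
  have hu₁ : β₁ • cplx (n₁ ⨯₃ n₂) = (0 : ℂ) • cplx ((n₁ ⨯₃ n₂) ⨯₃ n₁) + β₁ • cplx (n₁ ⨯₃ n₂) := by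
    simp
  have hu₂ : β₂ • cplx (n₁ ⨯₃ n₂) = (0 : ℂ) • cplx ((n₁ ⨯₃ n₂) ⨯₃ n₂) + β₂ • cplx (n₁ ⨯₃ n₂) := by
    simp
  rw [nonInteracting_frame_iff hk hu₁ hu₂]
  simp

end KY

end Literature.Analysis.FluidPDE
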